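import Mathlib.Tactic
import Literature.Barriers.CriticalPhenomena.RigorousRGSmallParameterHHWThm22CertStep
import HarnessLib

/-!
# Hara–Hattori–Watanabe 2001, Theorem 2.2: certificate soundness, part 4 (Proposition 5.1 for the run, and `check = true` in real numbers)

Last theorem-only file on the meaning of `Thm22Cert.Cfg.check` (Hara–Hattori–Watanabe, CMP 220
(2001), Proposition 5.1 and §5.3). Flags propagate along the proof-side `run`; the initial state
encloses (5.2); **`run_sound`** (Proposition 5.1): every state of a successful run encloses a
family of sequences with `a_{0,N} = 1`, `a_{n,N} ≥ 0`, (A.6), linked by the recursion (5.7)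
(`a_{n,N+1} = ã_n/ã_0` with `ã_n = Σ_m (β/2)^m b_{m+n} tildeCoef m n`) from the Ising initial values
(5.2) at `s = sNum/10¹⁶`; `hist` lists the run and `stateAt` reads it. Finally **`check_sound`**: if
`Cfg.check = true` then, for such families `a⁻`, `a⁺` at `s₋`, `s₊`: (2.17) `a⁺_{1,N} < 2 + √2`
(`N₀ ≤ N < N₁`), (5.30) `a⁻_{1,N₁} < 1 < a⁺_{1,N₁}` and
`a⁺_{1,N₁} > 1 + (3/√2)(a⁺_{1,N₁}² - a⁺_{2,N₁})/2`, and (2.14)–(2.16) at `N₀` — with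
`μ₄ = (x₁² - x₂)/2`, `μ₆ = x₁³/3 - x₁x₂/2 + x₃/6`, `μ₈ = x₁⁴/4 - x₁²x₂/2 + x₂²/8 + x₁x₃/6 - x₄/24`
(§5.1, p. 15) — for every `x` between `a⁻_{·,N₀}` and `a⁺_{·,N₀}` ((5.31)–(5.34), the algebra of
`bounds_of_ineqs`).
-/

noncomputable section

namespace Literature.Barriers.CriticalPhenomena.HierarchicalRG.Thm22Cert

open Finset

namespace Cfg

variable {C : Cfg}

/-! ### The run and its history -/

/-- Flags propagate backwards along the run. [folklore] -/
theorem run_flag_of_le {T : Tab} {sNum : ℕ} {K : ℕ} (h : (C.run T sNum K).2.2 = true) :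
    ∀ {N}, N ≤ K → (C.run T sNum N).2.2 = true := by
  induction K with
  | zero => intro N hN; have : N = 0 := by omega
            subst this; exact h
  | succ K ih =>
    intro N hN
    have hK : (C.run T sNum K).2.2 = true := (step_flag_sound h).1
    rcases Nat.lt_or_ge N (K + 1) with hlt | hge
    · exact ih hK (by omega)
    · have : N = K + 1 := by omega
      subst this; exact h

/-- The initial state encloses the initial values (5.2). [cite: HaraHattoriWatanabe2001, §5.1 eq. (5.2)] -/
theorem init_Encl (sNum : ℕ) {a0 : ℕ → ℝ}
    (ha : ∀ n, n ≤ C.M → a0 n = (n.factorial : ℝ) / (2 * n).factorial * ((sNum : ℝ) / 10 ^ 16) ^ (2 * n)) :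
    C.Encl (C.init sNum).1 (C.init sNum).2.1 a0 := by
  intro n hn
  unfold init
  simp only
  rw [get_map_range _ (by omega), get_map_range _ (by omega), ha n hn]
  exact C.init_sound sNum n

/-- **Soundness of the run (Proposition 5.1).** For a family of Newman sequences linked by the
recursion (5.7) and starting at (5.2), every state of a run whose final flag holds encloses the
family. [cite: HaraHattoriWatanabe2001, Proposition 5.1] -/
theorem run_sound (hs : C.sqrtOK = true) (hM : 1 ≤ C.M) (sNum : ℕ) {a : ℕ → ℕ → ℝ}
    (hz : ∀ N, a N 0 = 1) (hnn : ∀ N n, 0 ≤ a N n) (hA6 : ∀ N m n, a N (m + n) ≤ a N m * a N n) {K : ℕ}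
    (hrec : ∀ N n, N < K → n ≤ C.M → a (N + 1) n =
      (∑' m, ((beta (Real.sqrt 2) / 2) ^ m * bOf (a N) (m + n) * tildeCoef m n)) /
        (∑' m, ((beta (Real.sqrt 2) / 2) ^ m * bOf (a N) (m + 0) * tildeCoef m 0)))
    (h0 : ∀ n, n ≤ C.M → a 0 n = (n.factorial : ℝ) / (2 * n).factorial * ((sNum : ℝ) / 10 ^ 16) ^ (2 * n))
    (hflag : (C.run C.mkTab sNum K).2.2 = true) :
    ∀ N, N ≤ K → C.Encl (C.run C.mkTab sNum N).1 (C.run C.mkTab sNum N).2.1 (a N) := by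
  intro N
  induction N with
  | zero => intro _; exact init_Encl sNum h0
  | succ N ih =>
    intro hN
    have hE := ih (by omega)
    have hf : (C.run C.mkTab sNum (N + 1)).2.2 = true := run_flag_of_le hflag hN
    exact step_sound hs hM hE (hz N) (hnn N) (hA6 N) (fun n hn => hrec N n (by omega) hn) hf

/-- `hist` lists the run, latest first. [folklore] -/
theorem hist_eq (T : Tab) (sNum k : ℕ) :
    C.hist T sNum k = ((List.range (k + 1)).reverse).map (C.run T sNum) := by
  induction k with
  | zero => rfl
  | succ k ih =>
    have e : ∀ j, ((List.range (j + 1)).reverse).map (C.run T sNum) =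
        C.run T sNum j :: ((List.range j).reverse).map (C.run T sNum) := by
      intro j; simp [List.range_succ]
    rw [hist, ih, e, e, e]
    rfl

/-- Reading the history: the state at step `N ≤ nSteps` is `run N`. [folklore] -/
theorem stateAt_hist (T : Tab) (sNum : ℕ) {N : ℕ} (hN : N ≤ C.nSteps) :
    C.stateAt (C.hist T sNum C.nSteps) N = C.run T sNum N := by
  unfold stateAt
  have hlen : C.nSteps - N < (List.range (C.nSteps + 1)).length := by
    simp only [List.length_range]; omega
  rw [hist_eq, List.getD_eq_getElem?_getD, List.getElem?_map, List.getElem?_reverse hlen]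
  have e : (List.range (C.nSteps + 1)).length - 1 - (C.nSteps - N) = N := by
    simp only [List.length_range]; omega
  rw [e, List.getElem?_range (by omega)]
  rfl

/-! ### What `check = true` means for real coefficient families -/

/-- Unpacking `check = true`. [folklore] -/
theorem check_spec (h : C.check = true) :
    C.sqrtOK = true ∧ 4 ≤ C.M ∧ C.N0 ≤ C.nSteps ∧
    C.okRuns (C.hist C.mkTab sMinusNum C.nSteps) (C.hist C.mkTab sPlusNum C.nSteps) = true ∧
    C.chk217 (C.hist C.mkTab sPlusNum C.nSteps) = true ∧
    C.chk530 (C.hist C.mkTab sMinusNum C.nSteps) (C.hist C.mkTab sPlusNum C.nSteps) = true ∧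
    C.chkN0 (C.hist C.mkTab sMinusNum C.nSteps) (C.hist C.mkTab sPlusNum C.nSteps) = true := by
  unfold check finalChecks at h
  simp only [Bool.and_eq_true, decide_eq_true_eq] at h
  tauto

/-- The algebra of (5.31)–(5.34): from the integer inequalities of `chkN0` (scaled by
`O = 2^P`) to the bounds (2.14)–(2.16) for every `x` between the endpoint enclosures.
[cite: HaraHattoriWatanabe2001, §5.3 eqs. (5.31)–(5.34)] -/
theorem bounds_of_ineqs {O : ℝ} (hO : 0 < O) {am1 am2 am3 am4 ap1 ap2 ap3 ap4 : ℝ}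
    (hnn1 : 0 ≤ am1) (hnn2 : 0 ≤ am2) (hnn3 : 0 ≤ am3)
    (ca : ap2 * O ≤ am1 * am1)
    (cc : 10000 * (ap1 * ap1) ≤ 90 * O ^ 2 + 10000 * am2 * O)
    (cd : 24 * (ap1 * ap1 - am2 * O) ^ 2 + 30 * O ^ 2 * ap1 * ap2 ≤ 20 * O * am1 ^ 3 + 10 * O ^ 3 * am3)
    (ce : 400 * O * ap1 ^ 3 + 200 * O ^ 3 * ap3 ≤ 1821 * (am1 * am1 - ap2 * O) ^ 2 + 600 * O ^ 2 * am1 * am2)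
    (cf : 12 * O * ap1 ^ 2 * ap2 + O ^ 3 * ap4 ≤ 6 * am1 ^ 4 + 3 * O ^ 2 * am2 ^ 2 + 4 * O ^ 2 * am1 * am3)
    (cg : 6000 * O ^ 2 * ap1 ^ 4 + 3000 * O ^ 4 * ap2 ^ 2 + 4000 * O ^ 4 * ap1 * ap3 ≤
      145407 * (am1 * am1 - ap2 * O) ^ 3 + 12000 * O ^ 3 * am1 ^ 2 * am2 + 1000 * O ^ 5 * am4)
    {x : ℕ → ℝ} (h1 : am1 ≤ x 1 * O ∧ x 1 * O ≤ ap1) (h2 : am2 ≤ x 2 * O ∧ x 2 * O ≤ ap2)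
    (h3 : am3 ≤ x 3 * O ∧ x 3 * O ≤ ap3) (h4 : am4 ≤ x 4 * O ∧ x 4 * O ≤ ap4) :
    ((0 ≤ ((x 1 ^ 2 - x 2) / 2) ∧ ((x 1 ^ 2 - x 2) / 2) ≤ 0.0045) ∧
      (1.6 * ((x 1 ^ 2 - x 2) / 2) ^ 2 ≤ (x 1 ^ 3 / 3 - x 1 * x 2 / 2 + x 3 / 6) ∧ (x 1 ^ 3 / 3 - x 1 * x 2 / 2 + x 3 / 6) ≤ 6.07 * ((x 1 ^ 2 - x 2) / 2) ^ 2) ∧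
      (0 ≤ (x 1 ^ 4 / 4 - x 1 ^ 2 * x 2 / 2 + x 2 ^ 2 / 8 + x 1 * x 3 / 6 - x 4 / 24) ∧ (x 1 ^ 4 / 4 - x 1 ^ 2 * x 2 / 2 + x 2 ^ 2 / 8 + x 1 * x 3 / 6 - x 4 / 24) ≤ 48.469 * ((x 1 ^ 2 - x 2) / 2) ^ 3)) := by
  -- scaled variables
  set y1 := x 1 * O with hy1
  set y2 := x 2 * O with hy2
  set y3 := x 3 * O with hy3
  set y4 := x 4 * O with hy4
  have hy1nn : 0 ≤ y1 := hnn1.trans h1.1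
  have hy2nn : 0 ≤ y2 := hnn2.trans h2.1
  have hy3nn : 0 ≤ y3 := hnn3.trans h3.1
  set X := ap1 * ap1 - am2 * O with hX
  set Y := am1 * am1 - ap2 * O with hY
  set Z := y1 * y1 - y2 * O with hZ
  have hY0 : 0 ≤ Y := by rw [hY]; linarith
  have hsq1 : am1 * am1 ≤ y1 * y1 := mul_self_le_mul_self hnn1 h1.1
  have hsq1' : y1 * y1 ≤ ap1 * ap1 := mul_self_le_mul_self hy1nn h1.2
  have hYZ : Y ≤ Z := by
    have : ap2 * O ≥ y2 * O := mul_le_mul_of_nonneg_right h2.2 hO.le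
    rw [hY, hZ]; linarith
  have hZX : Z ≤ X := by
    have : am2 * O ≤ y2 * O := mul_le_mul_of_nonneg_right h2.1 hO.le
    rw [hZ, hX]; linarith
  have hZ0 : 0 ≤ Z := hY0.trans hYZ
  have hap1 : 0 ≤ ap1 := hy1nn.trans h1.2
  have hap2 : 0 ≤ ap2 := hy2nn.trans h2.2
  -- monomial comparisons
  have m12 : y1 * y2 ≤ ap1 * ap2 := mul_le_mul h1.2 h2.2 hy2nn hap1
  have m12' : am1 * am2 ≤ y1 * y2 := mul_le_mul h1.1 h2.1 hnn2 hy1nn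
  have m13 : y1 * y3 ≤ ap1 * ap3 := mul_le_mul h1.2 h3.2 hy3nn hap1
  have m13' : am1 * am3 ≤ y1 * y3 := mul_le_mul h1.1 h3.1 hnn3 hy1nn
  have m111 : am1 ^ 3 ≤ y1 ^ 3 := pow_le_pow_left₀ hnn1 h1.1 3
  have m111' : y1 ^ 3 ≤ ap1 ^ 3 := pow_le_pow_left₀ hy1nn h1.2 3
  have m1111 : am1 ^ 4 ≤ y1 ^ 4 := pow_le_pow_left₀ hnn1 h1.1 4
  have m1111' : y1 ^ 4 ≤ ap1 ^ 4 := pow_le_pow_left₀ hy1nn h1.2 4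
  have m22 : y2 ^ 2 ≤ ap2 ^ 2 := pow_le_pow_left₀ hy2nn h2.2 2
  have m22' : am2 ^ 2 ≤ y2 ^ 2 := pow_le_pow_left₀ hnn2 h2.1 2
  have m112 : y1 ^ 2 * y2 ≤ ap1 ^ 2 * ap2 :=
    mul_le_mul (pow_le_pow_left₀ hy1nn h1.2 2) h2.2 hy2nn (by positivity)
  have m112' : am1 ^ 2 * am2 ≤ y1 ^ 2 * y2 :=
    mul_le_mul (pow_le_pow_left₀ hnn1 h1.1 2) h2.1 hnn2 (by positivity)
  have hZ2 : Z ^ 2 ≤ X ^ 2 := pow_le_pow_left₀ hZ0 hZX 2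
  have hY2 : Y ^ 2 ≤ Z ^ 2 := pow_le_pow_left₀ hY0 hYZ 2
  have hY3 : Y ^ 3 ≤ Z ^ 3 := pow_le_pow_left₀ hY0 hYZ 3
  -- the scaled inequalities
  have hXc : 10000 * X ≤ 90 * O ^ 2 := by rw [hX]; linarith
  have kb : 10000 * Z ≤ 90 * O ^ 2 := by linarith
  have kc : 24 * Z ^ 2 ≤ 20 * O * y1 ^ 3 - 30 * O ^ 2 * (y1 * y2) + 10 * O ^ 3 * y3 := by
    have t1 : 30 * O ^ 2 * (y1 * y2) ≤ 30 * O ^ 2 * (ap1 * ap2) := mul_le_mul_of_nonneg_left m12 (by positivity)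
    have t2 : 20 * O * am1 ^ 3 ≤ 20 * O * y1 ^ 3 := mul_le_mul_of_nonneg_left m111 (by positivity)
    have t3 : 10 * O ^ 3 * am3 ≤ 10 * O ^ 3 * y3 := mul_le_mul_of_nonneg_left h3.1 (by positivity)
    linarith
  have kd : 400 * O * y1 ^ 3 - 600 * O ^ 2 * (y1 * y2) + 200 * O ^ 3 * y3 ≤ 1821 * Z ^ 2 := by
    have t1 : 400 * O * y1 ^ 3 ≤ 400 * O * ap1 ^ 3 := mul_le_mul_of_nonneg_left m111' (by positivity)
    have t2 : 200 * O ^ 3 * y3 ≤ 200 * O ^ 3 * ap3 := mul_le_mul_of_nonneg_left h3.2 (by positivity)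
    have t3 : 600 * O ^ 2 * (am1 * am2) ≤ 600 * O ^ 2 * (y1 * y2) := mul_le_mul_of_nonneg_left m12' (by positivity)
    have t4 : 1821 * Y ^ 2 ≤ 1821 * Z ^ 2 := by linarith
    linarith
  have ke : 0 ≤ 6 * y1 ^ 4 - 12 * O * (y1 ^ 2 * y2) + 3 * O ^ 2 * y2 ^ 2 + 4 * O ^ 2 * (y1 * y3) - O ^ 3 * y4 := by
    have t1 : 12 * O * (y1 ^ 2 * y2) ≤ 12 * O * (ap1 ^ 2 * ap2) := mul_le_mul_of_nonneg_left m112 (by positivity)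
    have t2 : O ^ 3 * y4 ≤ O ^ 3 * ap4 := mul_le_mul_of_nonneg_left h4.2 (by positivity)
    have t3 : 6 * am1 ^ 4 ≤ 6 * y1 ^ 4 := by linarith
    have t4 : 3 * O ^ 2 * am2 ^ 2 ≤ 3 * O ^ 2 * y2 ^ 2 := mul_le_mul_of_nonneg_left m22' (by positivity)
    have t5 : 4 * O ^ 2 * (am1 * am3) ≤ 4 * O ^ 2 * (y1 * y3) := mul_le_mul_of_nonneg_left m13' (by positivity)
    linarith
  have kf : 6000 * O ^ 2 * y1 ^ 4 - 12000 * O ^ 3 * (y1 ^ 2 * y2) + 3000 * O ^ 4 * y2 ^ 2 +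
      4000 * O ^ 4 * (y1 * y3) - 1000 * O ^ 5 * y4 ≤ 145407 * Z ^ 3 := by
    have t1 : 6000 * O ^ 2 * y1 ^ 4 ≤ 6000 * O ^ 2 * ap1 ^ 4 := mul_le_mul_of_nonneg_left m1111' (by positivity)
    have t2 : 3000 * O ^ 4 * y2 ^ 2 ≤ 3000 * O ^ 4 * ap2 ^ 2 := mul_le_mul_of_nonneg_left m22 (by positivity)
    have t3 : 4000 * O ^ 4 * (y1 * y3) ≤ 4000 * O ^ 4 * (ap1 * ap3) := mul_le_mul_of_nonneg_left m13 (by positivity)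
    have t4 : 145407 * Y ^ 3 ≤ 145407 * Z ^ 3 := by linarith
    have t5 : 12000 * O ^ 3 * (am1 ^ 2 * am2) ≤ 12000 * O ^ 3 * (y1 ^ 2 * y2) :=
      mul_le_mul_of_nonneg_left m112' (by positivity)
    have t6 : 1000 * O ^ 5 * am4 ≤ 1000 * O ^ 5 * y4 := mul_le_mul_of_nonneg_left h4.1 (by positivity)
    linarith
  -- back to `x`
  have hO2 : 0 < O ^ 2 := by positivity
  have hO4 : 0 < O ^ 4 := by positivity
  have hO6 : 0 < O ^ 6 := by positivity
  have eZ : Z = O ^ 2 * (x 1 ^ 2 - x 2) := by rw [hZ, hy1, hy2]; ring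
  have e4 : ((x 1 ^ 2 - x 2) / 2) = Z / (2 * O ^ 2) := by rw [eZ]; field_simp
  have e6 : (x 1 ^ 3 / 3 - x 1 * x 2 / 2 + x 3 / 6) = (20 * O * y1 ^ 3 - 30 * O ^ 2 * (y1 * y2) + 10 * O ^ 3 * y3) / (60 * O ^ 4) := by
    rw [hy1, hy2, hy3]; field_simp; ring
  have e8 : (x 1 ^ 4 / 4 - x 1 ^ 2 * x 2 / 2 + x 2 ^ 2 / 8 + x 1 * x 3 / 6 - x 4 / 24) = (6 * y1 ^ 4 - 12 * O * (y1 ^ 2 * y2) + 3 * O ^ 2 * y2 ^ 2 + 4 * O ^ 2 * (y1 * y3) -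
      O ^ 3 * y4) / (24 * O ^ 4) := by
    rw [hy1, hy2, hy3, hy4]; field_simp; ring
  refine ⟨⟨?_, ?_⟩, ⟨?_, ?_⟩, ⟨?_, ?_⟩⟩
  · rw [e4]; exact div_nonneg hZ0 (by positivity)
  · rw [e4, div_le_iff₀ (by positivity)]; linarith
  · rw [e4, e6, div_pow, le_div_iff₀ (by positivity)]
    calc 1.6 * (Z ^ 2 / (2 * O ^ 2) ^ 2) * (60 * O ^ 4) = 24 * Z ^ 2 := by field_simp; ring
      _ ≤ _ := kc
  · rw [e4, e6, div_pow, div_le_iff₀ (by positivity)]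
    calc 20 * O * y1 ^ 3 - 30 * O ^ 2 * (y1 * y2) + 10 * O ^ 3 * y3
        ≤ 1821 * Z ^ 2 / 20 := by linarith
      _ = 6.07 * (Z ^ 2 / (2 * O ^ 2) ^ 2) * (60 * O ^ 4) := by field_simp; ring
  · rw [e8]; exact div_nonneg ke (by positivity)
  · rw [e4, e8, div_pow, div_le_iff₀ (by positivity)]
    calc 6 * y1 ^ 4 - 12 * O * (y1 ^ 2 * y2) + 3 * O ^ 2 * y2 ^ 2 + 4 * O ^ 2 * (y1 * y3) - O ^ 3 * y4
        ≤ 145407 * Z ^ 3 / (1000 * O ^ 2) := by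
          rw [le_div_iff₀ (by positivity)]
          calc (6 * y1 ^ 4 - 12 * O * (y1 ^ 2 * y2) + 3 * O ^ 2 * y2 ^ 2 + 4 * O ^ 2 * (y1 * y3) - O ^ 3 * y4) *
                (1000 * O ^ 2) = 6000 * O ^ 2 * y1 ^ 4 - 12000 * O ^ 3 * (y1 ^ 2 * y2) + 3000 * O ^ 4 * y2 ^ 2 +
                4000 * O ^ 4 * (y1 * y3) - 1000 * O ^ 5 * y4 := by ring
            _ ≤ _ := kf
      _ = 48.469 * (Z ^ 3 / (2 * O ^ 2) ^ 3) * (24 * O ^ 4) := by field_simp; ring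

/-- `3/√2 = 3√2/2`. [folklore] -/
theorem three_div_sqrt_two : (3 : ℝ) / Real.sqrt 2 = 3 * Real.sqrt 2 / 2 := by
  have h2 : Real.sqrt 2 * Real.sqrt 2 = 2 := Real.mul_self_sqrt (by norm_num)
  have hne : Real.sqrt 2 ≠ 0 := by positivity
  rw [div_eq_iff hne]
  nlinarith

/-- **The certificate, read in real numbers.** If `check = true` and `aM`, `aP` are coefficient
families at `s₋`, `s₊` (Newman sequences, recursion (5.7), initial values (5.2)), then:
(2.17) `a⁺_{1,N} < 2 + √2` for `N₀ ≤ N < N₁`; (5.30) `a⁻_{1,N₁} < 1` and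
`a⁺_{1,N₁} > 1 + (3/√2)(a⁺_{1,N₁}² - a⁺_{2,N₁})/2` (in particular `> 1`); and (2.14)–(2.16) hold at
`N₀` for every `x` with `a⁻_{n,N₀} ≤ x_n ≤ a⁺_{n,N₀}`, `n = 1,…,4` ((5.31)–(5.34)).
[cite: HaraHattoriWatanabe2001, Theorem 2.2, Proposition 5.1 and §5.3] -/
theorem check_sound (h : C.check = true) {aM aP : ℕ → ℕ → ℝ}
    (hM0 : ∀ N, aM N 0 = 1) (hMnn : ∀ N n, 0 ≤ aM N n) (hMA6 : ∀ N m n, aM N (m + n) ≤ aM N m * aM N n)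
    (hMrec : ∀ N n, aM (N + 1) n = (∑' m, ((beta (Real.sqrt 2) / 2) ^ m * bOf (aM N) (m + n) * tildeCoef m n)) /
      (∑' m, ((beta (Real.sqrt 2) / 2) ^ m * bOf (aM N) (m + 0) * tildeCoef m 0)))
    (hMinit : ∀ n, aM 0 n = (n.factorial : ℝ) / (2 * n).factorial * ((sMinusNum : ℝ) / 10 ^ 16) ^ (2 * n))
    (hP0 : ∀ N, aP N 0 = 1) (hPnn : ∀ N n, 0 ≤ aP N n) (hPA6 : ∀ N m n, aP N (m + n) ≤ aP N m * aP N n)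
    (hPrec : ∀ N n, aP (N + 1) n = (∑' m, ((beta (Real.sqrt 2) / 2) ^ m * bOf (aP N) (m + n) * tildeCoef m n)) /
      (∑' m, ((beta (Real.sqrt 2) / 2) ^ m * bOf (aP N) (m + 0) * tildeCoef m 0)))
    (hPinit : ∀ n, aP 0 n = (n.factorial : ℝ) / (2 * n).factorial * ((sPlusNum : ℝ) / 10 ^ 16) ^ (2 * n)) :
    (∀ N, C.N0 ≤ N → N < C.nSteps → aP N 1 < 2 + Real.sqrt 2) ∧
    aM C.nSteps 1 < 1 ∧ 1 < aP C.nSteps 1 ∧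
    1 + 3 / Real.sqrt 2 * ((aP C.nSteps 1 ^ 2 - aP C.nSteps 2) / 2) < aP C.nSteps 1 ∧
    (∀ x : ℕ → ℝ, (∀ n, 1 ≤ n → n ≤ 4 → aM C.N0 n ≤ x n ∧ x n ≤ aP C.N0 n) →
      ((0 ≤ ((x 1 ^ 2 - x 2) / 2) ∧ ((x 1 ^ 2 - x 2) / 2) ≤ 0.0045) ∧
      (1.6 * ((x 1 ^ 2 - x 2) / 2) ^ 2 ≤ (x 1 ^ 3 / 3 - x 1 * x 2 / 2 + x 3 / 6) ∧ (x 1 ^ 3 / 3 - x 1 * x 2 / 2 + x 3 / 6) ≤ 6.07 * ((x 1 ^ 2 - x 2) / 2) ^ 2) ∧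
      (0 ≤ (x 1 ^ 4 / 4 - x 1 ^ 2 * x 2 / 2 + x 2 ^ 2 / 8 + x 1 * x 3 / 6 - x 4 / 24) ∧ (x 1 ^ 4 / 4 - x 1 ^ 2 * x 2 / 2 + x 2 ^ 2 / 8 + x 1 * x 3 / 6 - x 4 / 24) ≤ 48.469 * ((x 1 ^ 2 - x 2) / 2) ^ 3))) := by
  obtain ⟨hs, hM4, hN0, hok, h217, h530, hN0c⟩ := check_spec h
  obtain ⟨hs1, hs2, hs3⟩ := C.sqrtOK_sound hs
  have hO := C.one_pos
  set O : ℝ := (C.one : ℝ) with hOdef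
  -- run flags and enclosures
  unfold okRuns at hok
  rw [Bool.and_eq_true, stateAt_hist _ _ le_rfl, stateAt_hist _ _ le_rfl] at hok
  have EM := run_sound hs (by omega) sMinusNum hM0 hMnn hMA6 (K := C.nSteps)
    (fun N n _ _ => hMrec N n) (fun n _ => hMinit n) hok.1
  have EP := run_sound hs (by omega) sPlusNum hP0 hPnn hPA6 (K := C.nSteps)
    (fun N n _ _ => hPrec N n) (fun n _ => hPinit n) hok.2
  refine ⟨?_, ?_, ?_, ?_, ?_⟩
  · -- (2.17)
    intro N hN1 hN2
    unfold chk217 at h217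
    simp only [List.all_eq_true, List.mem_range, decide_eq_true_eq] at h217
    have := h217 (N - C.N0) (by omega)
    rw [show C.N0 + (N - C.N0) = N by omega, stateAt_hist _ _ hN2.le] at this
    have hup := ((EP N hN2.le) 1 (by omega)).2
    have hlt : (get (C.run C.mkTab sPlusNum N).2.1 1 : ℝ) < 2 * O + C.s2L := by
      rw [hOdef]; exact_mod_cast this
    have h3 : aP N 1 * O < (2 + Real.sqrt 2) * O := by rw [hOdef] at hlt ⊢; linarith
    exact lt_of_mul_lt_mul_right h3 hO.le
  · -- a⁻_{1,N₁} < 1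
    unfold chk530 at h530
    simp only [decide_eq_true_eq] at h530
    obtain ⟨c1, -, -, -⟩ := h530
    rw [stateAt_hist _ _ le_rfl] at c1
    have hup := ((EM C.nSteps le_rfl) 1 (by omega)).2
    have : (get (C.run C.mkTab sMinusNum C.nSteps).2.1 1 : ℝ) < O := by rw [hOdef]; exact_mod_cast c1
    have h3 : aM C.nSteps 1 * O < 1 * O := by linarith
    exact lt_of_mul_lt_mul_right h3 hO.le
  · -- 1 < a⁺_{1,N₁}
    unfold chk530 at h530
    simp only [decide_eq_true_eq] at h530
    obtain ⟨-, c2, -, -⟩ := h530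
    rw [stateAt_hist _ _ le_rfl] at c2
    have hlo := ((EP C.nSteps le_rfl) 1 (by omega)).1
    have : O < (get (C.run C.mkTab sPlusNum C.nSteps).1 1 : ℝ) := by rw [hOdef]; exact_mod_cast c2
    have h3 : 1 * O < aP C.nSteps 1 * O := by linarith
    exact lt_of_mul_lt_mul_right h3 hO.le
  · -- (5.30) at s₊
    unfold chk530 at h530
    simp only [decide_eq_true_eq] at h530
    obtain ⟨-, c2, c3, c4⟩ := h530
    rw [stateAt_hist _ _ le_rfl] at c2 c3 c4
    set lp1 : ℝ := ((get (C.run C.mkTab sPlusNum C.nSteps).1 1 : ℕ) : ℝ) with hlp1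
    set lp2 : ℝ := ((get (C.run C.mkTab sPlusNum C.nSteps).1 2 : ℕ) : ℝ) with hlp2
    set hp1 : ℝ := ((get (C.run C.mkTab sPlusNum C.nSteps).2.1 1 : ℕ) : ℝ) with hhp1
    have c3r : lp2 * O ≤ hp1 * hp1 := by rw [hlp2, hhp1, hOdef]; exact_mod_cast c3
    have c4r : 4 * O ^ 3 + 3 * C.s2H * (hp1 * hp1) < 4 * O ^ 2 * lp1 + 3 * C.s2H * lp2 * O := by
      rw [hlp1, hlp2, hhp1, hOdef]; exact_mod_cast c4
    obtain ⟨hl1, hu1⟩ := (EP C.nSteps le_rfl) 1 (by omega)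
    obtain ⟨hl2, -⟩ := (EP C.nSteps le_rfl) 2 (by omega)
    rw [← hlp1] at hl1; rw [← hhp1] at hu1; rw [← hlp2] at hl2
    set a1 := aP C.nSteps 1
    set a2 := aP C.nSteps 2
    have ha1 : 0 ≤ a1 := hPnn _ 1
    have hsq : (a1 * O) * (a1 * O) ≤ hp1 * hp1 := mul_self_le_mul_self (by positivity) hu1
    -- μ₄ ≤ μ̄ and μ̄ ≥ 0
    have hmu : (a1 ^ 2 - a2) / 2 ≤ (hp1 * hp1 - lp2 * O) / (2 * O ^ 2) := by
      rw [div_le_div_iff₀ (by norm_num) (by positivity)]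
      have t : lp2 * O ≤ a2 * O * O := mul_le_mul_of_nonneg_right hl2 hO.le
      nlinarith [hsq, t]
    have hmubar : 0 ≤ (hp1 * hp1 - lp2 * O) / (2 * O ^ 2) := by
      apply div_nonneg _ (by positivity); linarith
    have hcoef : 3 / Real.sqrt 2 ≤ 3 * C.s2H / (2 * O) := by
      rw [three_div_sqrt_two, div_le_div_iff₀ (by norm_num) (by positivity)]
      have : 3 * Real.sqrt 2 * (2 * O) = 3 * 2 * (Real.sqrt 2 * O) := by ring
      rw [this]; linarith
    have hcoef0 : 0 ≤ 3 / Real.sqrt 2 := by positivity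
    calc 1 + 3 / Real.sqrt 2 * ((a1 ^ 2 - a2) / 2)
        ≤ 1 + 3 / Real.sqrt 2 * ((hp1 * hp1 - lp2 * O) / (2 * O ^ 2)) := by gcongr
      _ ≤ 1 + 3 * C.s2H / (2 * O) * ((hp1 * hp1 - lp2 * O) / (2 * O ^ 2)) := by gcongr
      _ < lp1 / O := by
          rw [div_mul_div_comm, ← sub_pos]
          have e : lp1 / O - (1 + 3 * C.s2H * (hp1 * hp1 - lp2 * O) / (2 * O * (2 * O ^ 2))) =
              (4 * O ^ 2 * lp1 + 3 * C.s2H * lp2 * O - (4 * O ^ 3 + 3 * C.s2H * (hp1 * hp1))) / (4 * O ^ 3) := by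
            field_simp; ring
          rw [e]; exact div_pos (by linarith) (by positivity)
      _ ≤ a1 := by rw [div_le_iff₀ hO]; exact hl1
  · -- (2.14)–(2.16) at N₀
    intro x hx
    unfold chkN0 at hN0c
    simp only [decide_eq_true_eq] at hN0c
    rw [stateAt_hist _ _ hN0, stateAt_hist _ _ hN0] at hN0c
    obtain ⟨ca, cb, cc, cd, ce, cf, cg⟩ := hN0c
    have EMn := EM C.N0 hN0
    have EPn := EP C.N0 hN0
    set Lm := (C.run C.mkTab sMinusNum C.N0).1
    set Hp := (C.run C.mkTab sPlusNum C.N0).2.1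
    -- casts (the two natural subtractions are proper by `ca`, `cb`)
    have cXr : ((get Hp 1 * get Hp 1 - get Lm 2 * C.one : ℕ) : ℝ) = (get Hp 1 : ℝ) * get Hp 1 - get Lm 2 * O := by
      rw [hOdef]; push_cast [Nat.cast_sub cb]; ring
    have cYr : ((get Lm 1 * get Lm 1 - get Hp 2 * C.one : ℕ) : ℝ) = (get Lm 1 : ℝ) * get Lm 1 - get Hp 2 * O := by
      rw [hOdef]; push_cast [Nat.cast_sub ca]; ring
    have bnd : ∀ n, 1 ≤ n → n ≤ 4 → (get Lm n : ℝ) ≤ x n * O ∧ x n * O ≤ (get Hp n : ℝ) := by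
      intro n hn1 hn4
      obtain ⟨hxl, hxu⟩ := hx n hn1 hn4
      refine ⟨((EMn n (by omega)).1).trans ?_, le_trans ?_ ((EPn n (by omega)).2)⟩
      · exact mul_le_mul_of_nonneg_right hxl hO.le
      · exact mul_le_mul_of_nonneg_right hxu hO.le
    refine bounds_of_ineqs hO (am1 := get Lm 1) (am2 := get Lm 2) (am3 := get Lm 3) (am4 := get Lm 4)
      (ap1 := get Hp 1) (ap2 := get Hp 2) (ap3 := get Hp 3) (ap4 := get Hp 4)
      (by positivity) (by positivity) (by positivity) ?_ ?_ ?_ ?_ ?_ ?_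
      (bnd 1 le_rfl (by norm_num)) (bnd 2 (by norm_num) (by norm_num)) (bnd 3 (by norm_num) (by norm_num))
      (bnd 4 (by norm_num) le_rfl)
    · rw [hOdef]; exact_mod_cast ca
    · rw [hOdef]; exact_mod_cast cc
    · rw [← cXr, hOdef]; exact_mod_cast cd
    · rw [← cYr, hOdef]; exact_mod_cast ce
    · rw [hOdef]; exact_mod_cast cf
    · rw [← cYr, hOdef]; exact_mod_cast cg

end Cfg

end Literature.Barriers.CriticalPhenomena.HierarchicalRG.Thm22Cert

end
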